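/-
Copyright (c) 2026 the pub-hodgecm-mathlib formalisation cell (harness21).  Prover seat hodgecm-mathlib-R90-C133-p03 (g2) (free S5 hand spilled to S8 per
LEAD #21∕#31 (E); deal S8-R37 (4) 2026-09-04T22:17:54Z, byte ruling S8-R39 22:19:25Z), Track B ∕ K2-LIT, h413 = `stmt-HodgeConjecture-24833`, R90-TF section S8
«ContSpec-n½», file F1 of R90-C14-p02's census `R90/S8/CENSUS-sock2-chain.R90-C14-p02-g0.md` (c): the G-PRINT twin of ★ p862113 — an irreducible of
`L²_res(U(Φ₃))` lies in the closed span of the character lines `ℂ·[ψ̄∘det]` and the middle-residue blocks, MODULO the named level letters, (HEAD₃) kept as a letter.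
-/
import Summits.HodgeConjecture.HodgeConjecture.Theorems.R90S8ResidualLeClosureOfLevelLetters   -- ★ p862066 (K2E1-p15): `residual_le_topologicalClosure_of_level_letters` (LAYER 2, generic datum; brings ★ LAYER 1, ★ `residualSubspace`)
import Summits.HodgeConjecture.HodgeConjecture.Theorems.R90S8ResidualDefs                     -- ★ D-S8-2′: `charLine₃`, `IsPiN`, `qsForm`; brings ★ `cmResidualSubspaceR`∕`cmCuspidalSubspaceR`∕`cmParabolicDataR` (★ `K2E1CuspidalSpectrumUnitaryDefsR`)
import HarnessLib

/-!
# S8 #2 road, LAYER 2 G-PRINT — `R90S8ResGLeClosureOfLettersU3`: an irreducible constituent `P` of `L²_res(U(Φ₃)_{L∕L⁺})` lies in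
# `closure ((⨆_ψ ℂ·[ψ̄∘det]) ⊔ (⨆_k Πⁿ_k))`, MODULO the six level letters (D₃)(HEAD₃)(E_blk,₃)(O₃)(N_blk,₃)(L₃) — (HEAD₃) a LETTER (no ★ supplier at `N = 3`)

Track B ∕ K2-LIT, crux h413 = `stmt-HodgeConjecture-24833`, route of record `HCCMUnconditional`; cell `hodgecm-mathlib`, R90-TF programme, section S8 «ContSpec-n½»,
socket #2 `sock_S8_res_classification` of `Lines/R90_S8_ResidualSpectrumU3B.lean` :205–:214 («every irreducible `P ≤ L²_res(U(Φ₃))` is one-dimensional or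
`IsPiN P μω hμu ξ`»).  THEOREMS ONLY (no `def`, no `instance`, no `notation`, no named-fact hypothesis, no `sorry`; default heartbeats); lane
`--supports stmt-HodgeConjecture-24833 --as helper` (count-neutral).  CLOSES NO SOCKET.

THE CHAIN FOR #2 (census (c), S8-R37∕R39): letters ⟹ **F1 (this file)** `P.space ≤ closure C` ⟹ F2 `R90S8ResGClassificationOfClosureU3`
(R90-C14-p02; `isOneDimensional_or_exists_isPiN`, hypothesis `hle` = THIS CONCLUSION, BYTE-IDENTICAL) ⟹ #2's disjunction.  B ED. 5's line (R90-CS-typ2 pen):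
`sock_S8_res_classification := fun L _ _ _ μ _ μω hμu _ P hPres => isOneDimensional_or_exists_isPiN L μ μω hμu ξ Bn hBn P
(residualG_le_topologicalClosure_of_letters L μ P hPres Iso Blk At Ln Bn hD hHead hEblk hO hN hL)` — #2 PAID MODULO the six level letters + `hBn` (the
recommended socket `sock_S8_res_middleResidue_isPiN`, EXTERNAL-class local identification [Rogawski1990 §12.2 (3)]); the same honesty shape as the H side (★ p862113),
where (HEAD) is ★ `blocks_open` — at `N = 3` it is the XL item R1₃ (Langlands' `L²` decomposition for `U(2,1)`, [MoeglinWaldspurger1995 II.2.4, V.3.13]; census (d)(i)).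

SHAPE (forced by the byte ruling S8-R39 «`C` = F2's `hle` RHS bytes, ONE spelling»): F2, ★ `charLine₃`, ★ `IsPiN` and #2 live on the B-CARRIER
`UnitaryGroup.cmDatum L 3 (qsForm L)`; the E1 Eisenstein currency (`borelHeight`, `eisensteinSeriesU`, `chiSectionSpacePair`) lives on `quasiSplit L⁺ L c 3 =
cmDatum L 3 ((antidiagonal 3).over L)`, equal to the B-carrier only PROPOSITIONALLY (★ `StdForm.over_antidiagonal_eq` is `ext`; the J-S8-Wform-1 seam, census (a),
file F3).  Hence this print is typed ON THE B-CARRIER with the level letters ABSTRACT exactly as in ★ p862066 (index `ι` = levels∕`K`-types, `Iso i` = the isotypic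
piece, `β i` = block index, `Blk∕At∕Ln i b` = block, residue atoms, unitary-axis lines) — so it carries NO currency decision (character vs `K`-type currency at the
non-abelian `K_∞ = U(2) × U(1)`, census (d)(i)(α), stays open) — and the concrete Eisenstein bytes of (HEAD₃)∕(E_blk,₃) reach these binders through F3 when typed.
`cmResidualSubspaceR L 3 μ`, `cmCuspidalSubspaceR L 3 μ` are the `abbrev`s ★ `residualSubspace`∕`cuspidalSubspace` at `(cmDatum L 3 (qsForm L), μ, cmParabolicDataR L 3)`
(`qsForm L` IS the `Matrix.of` literal of ★ `K2E1CuspidalSpectrumUnitaryDefsR`), so ★ p862066 applies by `rfl` on the carriers.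

THE LETTERS (binders, B-carrier; `i : ι`, `b : β i`):
* (D₃) `hD` — density of the isotypic pieces `P ∩ Iso i` in `P` (payable at abelian level groups by ★ p862383 `le_topologicalClosure_iSup_inf_iso`);
* (HEAD₃) `hHead` — EXHAUSTION `(L²_cusp)ᗮ ∩ Iso i ≤ closure ⨆_b Blk i b` [MoeglinWaldspurger1995 II.2.4]: a LETTER here (XL at `N = 3`, census (d)(i));
* (E_blk,₃) `hEblk : Blk i b ≤ closure (At i b ⊔ Ln i b)`; (O₃) `hO : (⨆_b At i b) ⟂ (⨆_b Ln i b)` (★ `isOrtho_iSup_atoms_lines_of_blocks` from (O_blk) + R6);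
  (N_blk,₃) `hN` — irreducibles of `L²_res` carry no line mass; (L₃) `hL : At i b ≤ C` — the TOP-pole atoms are character lines (census (L₃-i), file F6) and the
  MIDDLE-pole atoms lie in the blocks `Bn k` (census (L₃-ii), the `Πⁿ` socket).
* target `C := (⨆ ψ automorphic, charLine₃ L ψ hψ μ) ⊔ ⨆ k, Bn k`, `Bn : κ → ClosedSubrep` ARBITRARY (F2's `hle` bytes; F2 labels `Bn k` by `ξ k : OneDimAutRepH L`).
§1 **`residualG_le_topologicalClosure_of_letters`** — THE PRINT on the B-carrier (one `exact` over ★ p862066; conclusion = F2's `hle`).  §2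
`residualG_le_topologicalClosure_of_letters_mono` — the same into any closed-span target `C′ ≥ C` (a consumer may enlarge the block family without retyping the
letters).  §3 `residualG_le_topologicalClosure_of_letters_quasiSplit` — the same print on Mok's carrier `quasiSplit L⁺ L c 3` (any `𝔓`, any irreducible closed
`P ≤ L²_res`), character-line lattice in ★ F6's bytes (`lineSubrep (cmDetChar L 3 ((antidiagonal 3).over L) ψ …) μ`): the carrier on which the E1 estate pays
(HEAD₃)∕(E_blk,₃)∕(D₃)∕(L₃) natively; its conclusion reaches §1's bytes through the closure-transport across the seam (K2E1-p11's sequel to F3, S8-R48 (1)).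
HONEST LABEL: HC_CM is proved only modulo the 7 printed citations (2 remaining named inputs: hLiu418 = `stmt-HodgeConjecture-24832`, h413 = `stmt-HodgeConjecture-24833`) until
rung 0 closes; REL ≠ ★ ≠ BUILT; this file asserts no named fact, is conditional by construction on its visible binders, and closes no socket (#2 stays OPEN modulo
(D₃)(HEAD₃)(E_blk,₃)(O₃)(N_blk,₃)(L₃) + `hBn`); count-neutral.

## References
* [MoeglinWaldspurger1995] C. Mœglin, J.-L. Waldspurger, *Spectral Decomposition and Eisenstein Series* (1995), I.2.18, II.2.4, V.3.13.
* [Rogawski1990] J. D. Rogawski, *Automorphic Representations of Unitary Groups in Three Variables* (1990), §13.9 p. 229 (i)–(ii) («the discrete non-cuspidal spectrum is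
  spanned by the residues of Eisenstein series»), §12.2 (3) p. 173, Thm. 13.3.6 (b) p. 202.
* [Langlands1976] R. P. Langlands, *On the Functional Equations Satisfied by Eisenstein Series*, LNM 544 (1976), §7.
-/

set_option autoImplicit false
set_option linter.dupNamespace false  -- the mandated namespace `…HodgeConjecture.HodgeConjecture.R90.S8` (LEAD #1 L1) repeats the summit's segment

noncomputable section

open MeasureTheory NumberField
open Literature.NumberTheory.Automorphic.Arthur2013.Leaves.TECR
open Literature.NumberTheory.Automorphic Literature.NumberTheory.Automorphic.UnitaryGroup
open Literature.NumberTheory.Rogawski1990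
open Summit.HodgeConjecture.HodgeConjecture.Cruxes.H413.K2E1CuspidalSpectrumUnitary (residualSubspace cmResidualSubspaceR cmCuspidalSubspaceR cmParabolicDataR)
open Summit.HodgeConjecture.HodgeConjecture.Cruxes.H413.R90S8ResidualDefs (charLine₃)

namespace Summit.HodgeConjecture.HodgeConjecture.R90.S8

open ContRepresentation

variable (L : Type) [Field L] [NumberField L] [IsCMField L]
  (μ : Measure (UnitaryGroup.cmDatum L 3 (qsForm L)).automorphicQuotient) [(UnitaryGroup.cmDatum L 3 (qsForm L)).IsAutomorphicMeasure μ]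

/-! ## §1 The print -/

/-- **LAYER 2 G-PRINT — an irreducible constituent of `L²_res(U(Φ₃))` lies in `closure ((⨆_ψ ℂ·[ψ̄∘det]) ⊔ (⨆_k Bn k))` modulo the six level letters**, (HEAD₃)
INCLUDED AS A LETTER: (D₃) `hD`, (HEAD₃) `hHead`, (E_blk,₃) `hEblk`, (O₃) `hO`, (N_blk,₃) `hN`, (L₃) `hL`; `P : DiscreteAutomorphicRep` with `P.space ≤ cmResidualSubspaceR L 3 μ`
(socket #2's binder, verbatim); conclusion = F2's `hle` hypothesis, byte for byte.  One `exact` over ★ `residual_le_topologicalClosure_of_level_letters` at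
`(cmDatum L 3 (qsForm L), μ, cmParabolicDataR L 3)`. [cite: MoeglinWaldspurger1995, I.2.18, II.2.4, V.3.13] [cite: Rogawski1990, §13.9 p. 229] -/
theorem residualG_le_topologicalClosure_of_letters
    (P : DiscreteAutomorphicRep (UnitaryGroup.cmDatum L 3 (qsForm L)) μ) (hPres : P.space ≤ cmResidualSubspaceR L 3 μ)
    {ι : Type*} (Iso : ι → Submodule ℂ ((UnitaryGroup.cmDatum L 3 (qsForm L)).L2 μ)) {β : ι → Type*}
    (Blk At Ln : ∀ i, β i → Submodule ℂ ((UnitaryGroup.cmDatum L 3 (qsForm L)).L2 μ))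
    {κ : Type*} (Bn : κ → ClosedSubrep ((UnitaryGroup.cmDatum L 3 (qsForm L)).rightRegular μ))
    (hD : P.space.toSubmodule ≤ (⨆ i, P.space.toSubmodule ⊓ Iso i).topologicalClosure)
    (hHead : ∀ i, (cmCuspidalSubspaceR L 3 μ).toSubmoduleᗮ ⊓ Iso i ≤ (⨆ b, Blk i b).topologicalClosure)
    (hEblk : ∀ i b, Blk i b ≤ (At i b ⊔ Ln i b).topologicalClosure)
    (hO : ∀ i, (⨆ b, At i b) ⟂ (⨆ b, Ln i b))
    (hN : ∀ i b, ∀ W : ClosedSubrep ((UnitaryGroup.cmDatum L 3 (qsForm L)).rightRegular μ), W.toContRep.IsTopIrreducible → W ≤ cmResidualSubspaceR L 3 μ →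
      W.toSubmodule ⊓ Iso i ≤ (Ln i b)ᗮ)
    (hL : ∀ i b, At i b ≤ (⨆ ψ : {ψ : ↥(TorusDict.torus (IsCMField.complexConj L)) →ₜ* ℂˣ // TorusDict.IsAutomorphic (IsCMField.complexConj L) ψ},
        (charLine₃ L ψ.1 ψ.2 μ).toSubmodule) ⊔ ⨆ k, (Bn k).toSubmodule) :
    P.space.toSubmodule ≤
      ((⨆ ψ : {ψ : ↥(TorusDict.torus (IsCMField.complexConj L)) →ₜ* ℂˣ // TorusDict.IsAutomorphic (IsCMField.complexConj L) ψ}, (charLine₃ L ψ.1 ψ.2 μ).toSubmodule) ⊔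
        ⨆ k, (Bn k).toSubmodule).topologicalClosure :=
  residual_le_topologicalClosure_of_level_letters (UnitaryGroup.cmDatum L 3 (qsForm L)) μ (cmParabolicDataR L 3) P.space P.irreducible hPres Iso Blk At Ln _
    hD hHead hEblk hO hN hL

/-! ## §2 Monotonicity in the target -/

/-- **The same print into any larger target** `C′ ⊇ (⨆_ψ ℂ·[ψ̄∘det]) ⊔ (⨆_k Bn k)`: the letters need not be retyped when a consumer enlarges the block family.
[cite: MoeglinWaldspurger1995, I.2.18, V.3.13] -/
theorem residualG_le_topologicalClosure_of_letters_mono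
    (P : DiscreteAutomorphicRep (UnitaryGroup.cmDatum L 3 (qsForm L)) μ) (hPres : P.space ≤ cmResidualSubspaceR L 3 μ)
    {ι : Type*} (Iso : ι → Submodule ℂ ((UnitaryGroup.cmDatum L 3 (qsForm L)).L2 μ)) {β : ι → Type*}
    (Blk At Ln : ∀ i, β i → Submodule ℂ ((UnitaryGroup.cmDatum L 3 (qsForm L)).L2 μ))
    {κ : Type*} (Bn : κ → ClosedSubrep ((UnitaryGroup.cmDatum L 3 (qsForm L)).rightRegular μ))
    (C' : Submodule ℂ ((UnitaryGroup.cmDatum L 3 (qsForm L)).L2 μ))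
    (hC' : (⨆ ψ : {ψ : ↥(TorusDict.torus (IsCMField.complexConj L)) →ₜ* ℂˣ // TorusDict.IsAutomorphic (IsCMField.complexConj L) ψ},
        (charLine₃ L ψ.1 ψ.2 μ).toSubmodule) ⊔ ⨆ k, (Bn k).toSubmodule ≤ C')
    (hD : P.space.toSubmodule ≤ (⨆ i, P.space.toSubmodule ⊓ Iso i).topologicalClosure)
    (hHead : ∀ i, (cmCuspidalSubspaceR L 3 μ).toSubmoduleᗮ ⊓ Iso i ≤ (⨆ b, Blk i b).topologicalClosure)
    (hEblk : ∀ i b, Blk i b ≤ (At i b ⊔ Ln i b).topologicalClosure)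
    (hO : ∀ i, (⨆ b, At i b) ⟂ (⨆ b, Ln i b))
    (hN : ∀ i b, ∀ W : ClosedSubrep ((UnitaryGroup.cmDatum L 3 (qsForm L)).rightRegular μ), W.toContRep.IsTopIrreducible → W ≤ cmResidualSubspaceR L 3 μ →
      W.toSubmodule ⊓ Iso i ≤ (Ln i b)ᗮ)
    (hL : ∀ i b, At i b ≤ (⨆ ψ : {ψ : ↥(TorusDict.torus (IsCMField.complexConj L)) →ₜ* ℂˣ // TorusDict.IsAutomorphic (IsCMField.complexConj L) ψ},
        (charLine₃ L ψ.1 ψ.2 μ).toSubmodule) ⊔ ⨆ k, (Bn k).toSubmodule) :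
    P.space.toSubmodule ≤ C'.topologicalClosure :=
  (residualG_le_topologicalClosure_of_letters L μ P hPres Iso Blk At Ln Bn hD hHead hEblk hO hN hL).trans (Submodule.topologicalClosure_mono hC')

/-! ## §3 The same print on Mok's quasi-split carrier `quasiSplit L⁺ L c 3` (where the E1 Eisenstein estate and ★ F6 pay the letters natively) -/

section QuasiSplit

variable (μq : Measure (quasiSplit (↥(maximalRealSubfield L)) L (IsCMField.complexConj L) 3).automorphicQuotient)
  [(quasiSplit (↥(maximalRealSubfield L)) L (IsCMField.complexConj L) 3).IsAutomorphicMeasure μq]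

/-- **LAYER 2 G-PRINT ON THE QUASI-SPLIT CARRIER** `U(J₃) = quasiSplit L⁺ L c 3` (`= cmDatum L 3 ((antidiagonal 3).over L)`, ★ `quasiSplit_eq_cmDatum` `rfl`): for ANY
family of unipotent radicals `𝔓` and any irreducible closed `P ≤ L²_res(U(J₃), 𝔓)`, the six level letters (all binders; (HEAD₃) a letter) give
`P ≤ closure ((⨆_ψ ℂ·[ψ̄∘det]) ⊔ (⨆_k Bn k))` with the character-line lattice in ★ F6's bytes (`K2E1ChiEisensteinTopResidueCharLineU3.span_le_iSup_lineSubrep_cmDetChar_three_of_forall_ae_eq`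
pays (L₃-i) into exactly this summand).  This is the carrier on which (HEAD₃)∕(E_blk,₃)∕(D₃)∕(L₃) are natively typed and paid; the conclusion is carried to §1's
B-carrier bytes (F2's `hle`) by the closure-transport across the `cmDatum L 3 (qsForm L) = quasiSplit … 3` seam (K2E1-p11's sequel to F3, S8-R48 (1)).
One `exact` over ★ `residual_le_topologicalClosure_of_level_letters`. [cite: MoeglinWaldspurger1995, I.2.18, II.2.4, V.3.13] [cite: Rogawski1990, §13.9 p. 229] -/
theorem residualG_le_topologicalClosure_of_letters_quasiSplit
    (𝔓 : (quasiSplit (↥(maximalRealSubfield L)) L (IsCMField.complexConj L) 3).ParabolicUnipotentData)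
    (P : ClosedSubrep ((quasiSplit (↥(maximalRealSubfield L)) L (IsCMField.complexConj L) 3).rightRegular μq)) (hP : P.toContRep.IsTopIrreducible)
    (hPres : P ≤ residualSubspace (quasiSplit (↥(maximalRealSubfield L)) L (IsCMField.complexConj L) 3) μq 𝔓)
    {ι : Type*} (Iso : ι → Submodule ℂ ((quasiSplit (↥(maximalRealSubfield L)) L (IsCMField.complexConj L) 3).L2 μq)) {β : ι → Type*}
    (Blk At Ln : ∀ i, β i → Submodule ℂ ((quasiSplit (↥(maximalRealSubfield L)) L (IsCMField.complexConj L) 3).L2 μq))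
    {κ : Type*} (Bn : κ → ClosedSubrep ((quasiSplit (↥(maximalRealSubfield L)) L (IsCMField.complexConj L) 3).rightRegular μq))
    (hD : P.toSubmodule ≤ (⨆ i, P.toSubmodule ⊓ Iso i).topologicalClosure)
    (hHead : ∀ i, ((quasiSplit (↥(maximalRealSubfield L)) L (IsCMField.complexConj L) 3).cuspidalSubspace μq 𝔓).toSubmoduleᗮ ⊓ Iso i ≤ (⨆ b, Blk i b).topologicalClosure)
    (hEblk : ∀ i b, Blk i b ≤ (At i b ⊔ Ln i b).topologicalClosure)
    (hO : ∀ i, (⨆ b, At i b) ⟂ (⨆ b, Ln i b))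
    (hN : ∀ i b, ∀ W : ClosedSubrep ((quasiSplit (↥(maximalRealSubfield L)) L (IsCMField.complexConj L) 3).rightRegular μq), W.toContRep.IsTopIrreducible →
      W ≤ residualSubspace (quasiSplit (↥(maximalRealSubfield L)) L (IsCMField.complexConj L) 3) μq 𝔓 → W.toSubmodule ⊓ Iso i ≤ (Ln i b)ᗮ)
    (hL : ∀ i b, At i b ≤ (⨆ ψ : {ψ : ↥(TorusDict.torus (IsCMField.complexConj L)) →ₜ* ℂˣ // TorusDict.IsAutomorphic (IsCMField.complexConj L) ψ},
        (AdelicGroupData.AutomorphicCharacter.lineSubrep (𝒢 := (quasiSplit (↥(maximalRealSubfield L)) L (IsCMField.complexConj L) 3))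
          (cmDetChar L 3 ((StdForm.antidiagonal 3).over L) ψ.1 ψ.2 ((Matrix.isUnit_iff_isUnit_det _).mp (StdForm.isUnit_over (StdForm.antidiagonal 3) L)).ne_zero) μq).toSubmodule) ⊔
        ⨆ k, (Bn k).toSubmodule) :
    P.toSubmodule ≤
      ((⨆ ψ : {ψ : ↥(TorusDict.torus (IsCMField.complexConj L)) →ₜ* ℂˣ // TorusDict.IsAutomorphic (IsCMField.complexConj L) ψ},
        (AdelicGroupData.AutomorphicCharacter.lineSubrep (𝒢 := (quasiSplit (↥(maximalRealSubfield L)) L (IsCMField.complexConj L) 3))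
          (cmDetChar L 3 ((StdForm.antidiagonal 3).over L) ψ.1 ψ.2 ((Matrix.isUnit_iff_isUnit_det _).mp (StdForm.isUnit_over (StdForm.antidiagonal 3) L)).ne_zero) μq).toSubmodule) ⊔
        ⨆ k, (Bn k).toSubmodule).topologicalClosure :=
  residual_le_topologicalClosure_of_level_letters (quasiSplit (↥(maximalRealSubfield L)) L (IsCMField.complexConj L) 3) μq 𝔓 P hP hPres Iso Blk At Ln _
    hD hHead hEblk hO hN hL

end QuasiSplit

end Summit.HodgeConjecture.HodgeConjecture.R90.S8

end
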